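import Summits.CriticalPhenomena.PercolationContinuityZ3.Theorems.PercNearOneGluingNoHeavyQuantIndepBlobHalfRow
import HarnessLib

/-!
# QUANT lane R8, FAR on trees: the TWO-LEVEL ROW for independent blobs with gates `≤ 1/2`
# (`EW > 2y + 1 ⟹ P(W ≥ y + 2) + P(W ≥ y + 1) ≥ 2 · g_min`, by doubling and reflection)

builds on p205010 (kernel theorem, internal audit signed; external expert review pending)

Support file (`--supports stmt-CriticalPhenomena-4575`), QUANT lane seat prim-quant-census-1 (gen 11); memo
`run/shared/lean/prim/quant/prim-quant-census-1/B4-SLIVER-G11.md` §4 (A-low).  Theorems only; no sorries; standard axioms.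
Companion of `…QuantIndepBlobTwoLevelRow.lean` (the same row for gates `≥ 1/2`, levels `y + 2`, `y`).

**Statement.**  `W = Σ a_x ζ_x` an independent blob sum with integer sizes and gates `p k ≤ 1/2`, least reliable blob `y₀`.  If
`EW > 2y + 1` (one unit LESS than block-star FAR needs at level `y + 2`) then `P(W ≥ y + 2) + P(W ≥ y + 1) ≥ 2 · p y₀`: FAR holds "at the
half-integer level `y + 3/2`".  This is lemma (A) of the memo (the two-level half-row) in the small-gate regime; it is the `λ ≥ 1/2` half of
the sliver form of TP1 = (B-4), the last open piece of census-1 gen 10's proof of `Quant.HubBlocksProfileIneq`.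

**Proof** (census-2 gen 46's doubling device, `Quant.IndepBlob.sum_weight_thin`, with NO loss of a factor `1/4`): write each gate as
`p k = (2 p k) · ½`; given the set `S` of blobs passing the first stage (gates `2p k ≤ 1`), `W` is a fair-coin subset sum over `S`.  If
`a(S) ≥ 2y + 2`, complementation `t ↦ S ∖ t` sends every `t ⊆ S` with `a(t) ≤ y` to a subset with `a ≥ y + 2`, so
`#{t : a(t) ≥ y+2} + #{t : a(t) ≥ y+1} ≥ 2^{#S}` (`card_powerset_le_card_add_card_reflect`), i.e. the conditional value of
`P(W ≥ y+2) + P(W ≥ y+1)` is `≥ 1`; and `P_{2p}(a(S) ≥ 2y + 2) ≥ 2 p y₀` is block-star FAR (`far_indepBlob_min`) for the doubled gates at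
`j = 2y + 1` (`2j < 2·EW`).  Sharp: `W = ζ + ζ'` with gates `½`, `y = 0`: `P(W ≥ 2) + P(W ≥ 1) = ¼ + ¾ = 1 = 2·½`. [this work]
-/

namespace Summit.CriticalPhenomena.PercolationContinuityZ3.Theorems

namespace Quant

namespace IndepBlob

open Finset

variable {κ : Type*} [Fintype κ] [DecidableEq κ]

omit [Fintype κ] in
/-- **Reflection count for two levels.**  If `∑_{k∈S} a k ≥ 2y + 2` then
`#(S.powerset) ≤ #{t ⊆ S : y + 2 ≤ a(t)} + #{t ⊆ S : y + 1 ≤ a(t)}`: a subset with `a(t) ≤ y` has complement `S ∖ t` of size `≥ y + 2`,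
and complementation is injective on the power set. [this work] -/
theorem card_powerset_le_card_add_card_reflect (S : Finset κ) (a : κ → ℕ) (y : ℕ)
    (hA : 2 * y + 2 ≤ ∑ k ∈ S, a k) :
    S.powerset.card ≤ (S.powerset.filter (fun t => y + 2 ≤ ∑ k ∈ t, a k)).card +
      (S.powerset.filter (fun t => y + 1 ≤ ∑ k ∈ t, a k)).card := by
  have hsplit := Finset.card_filter_add_card_filter_not (s := S.powerset) (fun t => y + 1 ≤ ∑ k ∈ t, a k)
  -- the light subsets inject into the heavy ones by complementation
  have hinj : (S.powerset.filter (fun t => ¬ (y + 1 ≤ ∑ k ∈ t, a k))).card ≤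
      (S.powerset.filter (fun t => y + 2 ≤ ∑ k ∈ t, a k)).card := by
    refine Finset.card_le_card_of_injOn (fun t => S \ t) (fun t ht => ?_) (fun t ht t' ht' he => ?_)
    · rw [Finset.mem_coe, Finset.mem_filter, Finset.mem_powerset] at ht
      show S \ t ∈ S.powerset.filter (fun t => y + 2 ≤ ∑ k ∈ t, a k)
      rw [Finset.mem_filter, Finset.mem_powerset]
      refine ⟨Finset.sdiff_subset, ?_⟩
      have hs : ∑ k ∈ S \ t, a k + ∑ k ∈ t, a k = ∑ k ∈ S, a k := Finset.sum_sdiff ht.1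
      omega
    · rw [Finset.mem_coe, Finset.mem_filter, Finset.mem_powerset] at ht ht'
      have h1 : S \ (S \ t) = t := Finset.sdiff_sdiff_eq_self ht.1
      have h2 : S \ (S \ t') = t' := Finset.sdiff_sdiff_eq_self ht'.1
      have he' : S \ (S \ t) = S \ (S \ t') := by
        show S \ ((fun t => S \ t) t) = S \ ((fun t => S \ t) t')
        rw [he]
      rw [h1, h2] at he'
      exact he'
  omega

omit [Fintype κ] in
/-- **Reflection count, weighted form.**  With fair coins on `S` (weight `(1/2)^{#S}` per subset) and `∑_{k∈S} a k ≥ 2y + 2`, the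
indicator of `{a(t) ≥ y + 2}` plus the indicator of `{a(t) ≥ y + 1}` has mean `≥ 1`. [this work] -/
theorem one_le_sum_powerset_two_levels (S : Finset κ) (a : κ → ℕ) (y : ℕ)
    (hA : 2 * y + 2 ≤ ∑ k ∈ S, a k) :
    (1 : ℝ) ≤ ∑ t ∈ S.powerset, (∏ k ∈ S, if k ∈ t then (1 / 2 : ℝ) else 1 - 1 / 2) *
        ((if y + 2 ≤ ∑ k ∈ t, a k then (1 : ℝ) else 0) + (if y + 1 ≤ ∑ k ∈ t, a k then (1 : ℝ) else 0)) := by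
  have hhalf : ∀ t : Finset κ, (∏ k ∈ S, if k ∈ t then (1 / 2 : ℝ) else 1 - 1 / 2) = (1 / 2) ^ S.card := by
    intro t
    rw [← Finset.prod_const]
    exact Finset.prod_congr rfl fun k _ => by split_ifs <;> norm_num
  simp_rw [hhalf, mul_add, mul_ite, mul_one, mul_zero]
  rw [Finset.sum_add_distrib, ← Finset.sum_filter, ← Finset.sum_filter, Finset.sum_const, Finset.sum_const, nsmul_eq_mul,
    nsmul_eq_mul]
  have hcard := card_powerset_le_card_add_card_reflect S a y hA
  rw [Finset.card_powerset] at hcard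
  have hcast : (2 : ℝ) ^ S.card ≤ ((S.powerset.filter (fun t => y + 2 ≤ ∑ k ∈ t, a k)).card : ℝ) +
      ((S.powerset.filter (fun t => y + 1 ≤ ∑ k ∈ t, a k)).card : ℝ) := by
    exact_mod_cast hcard
  have hpow : (0 : ℝ) < 2 ^ S.card := by positivity
  have hpow' : (1 / 2 : ℝ) ^ S.card * 2 ^ S.card = 1 := by
    rw [← mul_pow]; norm_num
  nlinarith [hpow, hpow']

/-- **Two-level row, all gates `≤ 1/2`.**  Gates `0 ≤ p k ≤ 1/2`, integer sizes `a k`, a least reliable blob `y₀` (`p y₀ ≤ p k` for all `k`),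
a level `y : ℕ`.  If `EW = ∑ a k · p k > 2y + 1` then
`2 · p y₀ ≤ P(W ≥ y + 2) + P(W ≥ y + 1) = Σ_{s : y+2 ≤ a(s)} w(s) + Σ_{s : y+1 ≤ a(s)} w(s)`.
(Block-star FAR needs `EW > 2y + 2` for `P(W ≥ y + 2) ≥ p y₀` alone.) [this work] -/
theorem twoLevelRow_of_gate_le_half (p : κ → ℝ) (a : κ → ℕ) (hp0 : ∀ k, 0 ≤ p k) (hhalf : ∀ k, p k ≤ 1 / 2)
    (y₀ : κ) (hy₀ : ∀ k, p y₀ ≤ p k) (y : ℕ)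
    (h : 2 * (y : ℝ) + 1 < ∑ k, (a k : ℝ) * p k) :
    2 * p y₀ ≤
      ∑ s ∈ (Finset.univ : Finset (Finset κ)).filter (fun s => y + 2 ≤ ∑ k ∈ s, a k), (∏ k, if k ∈ s then p k else 1 - p k) +
        ∑ s ∈ (Finset.univ : Finset (Finset κ)).filter (fun s => y + 1 ≤ ∑ k ∈ s, a k), (∏ k, if k ∈ s then p k else 1 - p k) := by
  set q : κ → ℝ := fun k => 2 * p k with hq
  have hq0 : ∀ k, 0 ≤ q k := fun k => by simp only [hq]; linarith [hp0 k]
  have hq1 : ∀ k, q k ≤ 1 := fun k => by simp only [hq]; linarith [hhalf k]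
  have hwq0 : ∀ S : Finset κ, 0 ≤ (∏ k, if k ∈ S then q k else 1 - q k) := bernoulliWeight_nonneg hq0 hq1
  set F : Finset κ → ℝ := fun s =>
    (if y + 2 ≤ ∑ k ∈ s, a k then (1 : ℝ) else 0) + (if y + 1 ≤ ∑ k ∈ s, a k then (1 : ℝ) else 0) with hF
  have hF0 : ∀ s, 0 ≤ F s := fun s => by
    simp only [hF]
    split_ifs <;> norm_num
  -- the two event probabilities as `∑_s w_{q·½}(s) F(s)`
  have hw : ∀ s : Finset κ, (∏ k, if k ∈ s then p k else 1 - p k) =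
      ∏ k, (if k ∈ s then q k * (1 / 2) else 1 - q k * (1 / 2)) := by
    intro s
    refine Finset.prod_congr rfl fun k _ => ?_
    have : q k * (1 / 2) = p k := by simp only [hq]; ring
    rw [this]
  have hLHS : ∑ s ∈ (Finset.univ : Finset (Finset κ)).filter (fun s => y + 2 ≤ ∑ k ∈ s, a k),
        (∏ k, if k ∈ s then p k else 1 - p k) +
      ∑ s ∈ (Finset.univ : Finset (Finset κ)).filter (fun s => y + 1 ≤ ∑ k ∈ s, a k),
        (∏ k, if k ∈ s then p k else 1 - p k) =
      ∑ s : Finset κ, (∏ k, if k ∈ s then q k * (1 / 2) else 1 - q k * (1 / 2)) * F s := by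
    rw [Finset.sum_filter, Finset.sum_filter, ← Finset.sum_add_distrib]
    refine Finset.sum_congr rfl fun s _ => ?_
    rw [hF, hw s, mul_add]
    congr 1 <;> split_ifs <;> simp
  rw [hLHS, sum_weight_thin q (fun _ => (1 / 2 : ℝ)) F]
  -- inner sums are nonnegative, and at least `1` on the doubled configurations of size `≥ 2y + 2`
  have hinner0 : ∀ S : Finset κ, 0 ≤ ∑ t ∈ S.powerset,
      (∏ k ∈ S, if k ∈ t then (1 / 2 : ℝ) else 1 - 1 / 2) * F t := by
    intro S
    refine Finset.sum_nonneg fun t _ => mul_nonneg (Finset.prod_nonneg fun k _ => ?_) (hF0 t)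
    split_ifs <;> norm_num
  set P2 := (Finset.univ : Finset (Finset κ)).filter (fun S => 2 * y + 2 ≤ ∑ k ∈ S, a k) with hP2
  have hstep1 : ∑ S ∈ P2, (∏ k, if k ∈ S then q k else 1 - q k) * 1 ≤
      ∑ S : Finset κ, (∏ k, if k ∈ S then q k else 1 - q k) *
        ∑ t ∈ S.powerset, (∏ k ∈ S, if k ∈ t then (1 / 2 : ℝ) else 1 - 1 / 2) * F t := by
    calc ∑ S ∈ P2, (∏ k, if k ∈ S then q k else 1 - q k) * 1
        ≤ ∑ S ∈ P2, (∏ k, if k ∈ S then q k else 1 - q k) *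
            ∑ t ∈ S.powerset, (∏ k ∈ S, if k ∈ t then (1 / 2 : ℝ) else 1 - 1 / 2) * F t := by
          refine Finset.sum_le_sum fun S hS => mul_le_mul_of_nonneg_left ?_ (hwq0 S)
          rw [hP2, Finset.mem_filter] at hS
          have := one_le_sum_powerset_two_levels S a y hS.2
          rw [hF]
          exact this
      _ ≤ _ := Finset.sum_le_sum_of_subset_of_nonneg (Finset.filter_subset _ _)
            fun S _ _ => mul_nonneg (hwq0 S) (hinner0 S)
  -- block-star FAR for the doubled gates at `j = 2y + 1`
  have hjm : 2 * (2 * (y : ℝ) + 1) < ∑ k, (a k : ℝ) * q k := by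
    have : ∑ k, (a k : ℝ) * q k = 2 * ∑ k, (a k : ℝ) * p k := by
      rw [Finset.mul_sum]
      refine Finset.sum_congr rfl fun k _ => ?_
      simp only [hq]
      ring
    rw [this]
    linarith
  have hfar := far_indepBlob_min q (fun k => (a k : ℝ)) hq0 hq1 (fun k => by positivity) y₀
    (fun k => by simp only [hq]; linarith [hy₀ k]) (2 * (y : ℝ) + 1) hjm
  have hcompl := Finset.sum_filter_add_sum_filter_not (Finset.univ : Finset (Finset κ))
    (fun S => 2 * y + 2 ≤ ∑ k ∈ S, a k) (fun S => (∏ k, if k ∈ S then q k else 1 - q k))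
  rw [sum_bernoulliWeight q] at hcompl
  have hsub : ∑ S ∈ (Finset.univ : Finset (Finset κ)).filter (fun S => ¬ (2 * y + 2 ≤ ∑ k ∈ S, a k)),
      (∏ k, if k ∈ S then q k else 1 - q k) ≤
      ∑ S ∈ (Finset.univ : Finset (Finset κ)).filter (fun S => ∑ k ∈ S, (a k : ℝ) ≤ 2 * (y : ℝ) + 1),
      (∏ k, if k ∈ S then q k else 1 - q k) := by
    refine Finset.sum_le_sum_of_subset_of_nonneg (fun S hS => ?_) fun S _ _ => hwq0 S
    rw [Finset.mem_filter] at hS ⊢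
    refine ⟨hS.1, ?_⟩
    have hlt : ∑ k ∈ S, a k ≤ 2 * y + 1 := by have := hS.2; omega
    have hcast : ((∑ k ∈ S, a k : ℕ) : ℝ) ≤ ((2 * y + 1 : ℕ) : ℝ) := by exact_mod_cast hlt
    push_cast at hcast
    exact hcast
  have hP2ge : 2 * p y₀ ≤ ∑ S ∈ P2, (∏ k, if k ∈ S then q k else 1 - q k) := by
    have hqy : q y₀ = 2 * p y₀ := by simp only [hq]
    rw [hP2]
    linarith
  rw [← Finset.sum_mul] at hstep1
  linarith
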